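import Summits.MatrixMultiplication.MatrixMultiplication.Theorems.EdgePencilDefectCuts
import Literature.Computability.AlgebraicComplexity.RectangularExponentSubadditivity
import Literature.Computability.AlgebraicComplexity.RectangularExponentSymmetry
import HarnessLib

/-!
# The ceiling of matrix-multiplication covers for the attacked leaf `TetraExcessZero`

Support kernel for `stmt-MatrixMultiplication-26697` (`TetraExcessZero : ω(K₄) ≤ ω(2,1,2)`, the attacked
leaf of the cut of record `closes : TetraExcessZero → TetraNoSaving → ω = 2`, route `TetrahedronCarving`
rev. 6; lineage `decomp-mm-lens-6` «barrier-complement carving», generation 22). It is the dual of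
`TetraResidualGroupingCeiling` (generation 18), which caps the GROUPING class for the residual
`TetraNoSaving`: here the COVER class for the attacked leaf is capped. No item is added or changed.

THE CLASS. An upper bound on `ω(K₄)` «by covers» writes `T(K₄)_n` as a restriction of a Kronecker
product of rectangular matrix-multiplication tensors `⟨n^{x_i}, n^{y_i}, n^{z_i}⟩` placed on triples (or
pairs) of the four parties and concludes `ω(K₄) ≤ Σ_i ω(x_i,y_i,z_i)` term by term. Every upper bound on
`ω(K₄)`, `ψ(ε)` (`EdgePencilExponent`), `χ(δ)` (`EdgePencilSixthLadder`) and `ω_diag(ε)`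
(`TetraDiagonalCover`) typed in this lineage is of this form (triangle × cherry, two triangles, block
covers, `ε·K₄ ⊕ (1−ε)·C₄`).

THE COUNT. Flattening rank is restriction-monotone and multiplicative, and the flattening of `⟨a,b,c⟩` at a
party is the product of its two bonds there; `T(K₄)_n` has flattening `n³` at each of its four vertices, so
the bond MASS `Σ_i (x_i + y_i + z_i)` of a cover is `≥ (4·3)/2 = 6` (for the sixth-edge ladder, edge `01`
at weight `δ`: `≥ 5 + δ`). By SYMMETRISATION — `(x+y+z)·ω ≤ 3·ω(x,y,z)` for real `x, y, z ≥ 0`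
(`sum_mul_omega_le_three_mul_omegaRect`; Lotti–Romani subadditivity for the three rotations, homogeneity
for the cube) — a rectangular shape costs at least `ω/3` per unit of bond mass
(`mass_mul_omega_le_three_mul_coverCost`). Hence:

* `two_mul_omega_le_coverCost` — **every cover certificate of `T(K₄)` costs `≥ 2ω`**;
* `matrixMultiplication_of_coverCertificate` / `coverCertificate_balanced_iff` — **a cover certifies
  `TetraExcessZero` (cost `≤ ω(2,1,2)`) iff `ω = 2`** (the «if» is the balanced four-triangle cover
  `4 × (1/2,1/2,1/2)`; the «only if» is `2ω ≤ ω(2,1,2) ⟹ ω = 2`, tree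
  `ConeTensor.two_mul_omega_le_omegaRect_two_one_two_iff`): INSIDE THE COVER CLASS THE ATTACKED LEAF IS
  SUMMIT-EQUIVALENT;
* `weightedCover_ceiling` — a cover certificate of mass `≥ 5 + δ` and cost `≤ ω(2,1,2)` (a rung
  `χ(δ) ≤ ω(2,1,2)` of the sixth-edge ladder certified by covers) forces `(5+δ)·ω ≤ 3·ω(2,1,2)`: the summit
  at `δ = 1`, and below it an absolute bound `ω ≤ 3·ω(2,1,2)/(5+δ)` (with the printed `ω(2,1,2) < 4.0884`,
  a cover-certified rung at `δ = 1/2` would mean `ω < 2.231`; at `δ ≤ 0.17` nothing beyond the record).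

This is the typed form of the tribunal's T5 line for item 26697 («ladder capped at `δ = 0`; lift = a
non-matrix-multiplication constituent»): an attack on `TetraExcessZero` must use a genuinely 4-partite
constituent whose cost per unit of bond mass is below `ω/3`. The higher-order Coppersmith–Winograd method
on `K₄` ([BrandEtAl2026, Thm. 48]: `ω(K₄) < 4.633908`, i.e. `0.7723` per unit of mass, below
`ω/3 < 0.7905` only if `ω > 2.3169`) is the one method in print of that kind; to certify the leaf outright
it would have to reach `ω(2,1,2)/6 ≤ 0.6814`. What is NOT typed here: the tensor-level dictionary
«cover ⟹ mass ≥ 6» (two flattening inequalities per vertex); the theorems quantify over the numerical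
certificate `(x_i, y_i, z_i)_i` a cover would produce, so they need no dictionary.

References: Lotti–Romani 1983 (`ω(·,·,·)` subadditive, homogeneous, symmetric) [LottiRomani1983];
Bläser 2013, Thm. 5.9 (symmetrisation) [Blaser2013]; Christandl–Vrana–Zuiddam, arXiv:1609.07476, §1.2–1.3
(graph tensors, `ω(K₄)`, covers by EPR triangles) [ChristandlVranaZuiddam2016]; Brand et al. 2026, Thm. 48
[BrandEtAl2026].
-/

noncomputable section

set_option linter.dupNamespace false

open scoped BigOperators
open Literature.Computability.AlgebraicComplexity
open Summit.MatrixMultiplication.MatrixMultiplication.Theorems.TetrahedronTensor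
open Summit.MatrixMultiplication.MatrixMultiplication.Theses.TetrahedronCarving

namespace Summit.MatrixMultiplication.MatrixMultiplication.Theorems.EdgePencil

section AnyField

variable (F : Type) [Field F]

/-! ## §1 The mass law -/

/-- **Symmetrisation for real shapes**: `(x+y+z)·ω ≤ 3·ω(x,y,z)` for `x, y, z ≥ 0` (glue the three rotations,
Lotti–Romani subadditivity twice, rescale the cube by homogeneity). The tree has this law as
`FarEdgeDescentCornerFold.sum_mul_omega_le_three_mul_omegaRect` (route `FarEdgeDescent`); it is re-derived
here from the Literature lemmas to keep the two routes' kernels import-independent.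
[cite: Blaser2013, Theorem 5.9] [cite: LottiRomani1983, §1] -/
theorem sum_mul_omega_le_three_mul_omegaRect {x y z : ℝ} (hx : 0 ≤ x) (hy : 0 ≤ y) (hz : 0 ≤ z) :
    (x + y + z) * omega F ≤ 3 * omegaRect F x y z := by
  have h1 := LottiRomani1983_subadditive F x y z y z x
  have h2 := LottiRomani1983_subadditive F (x + y) (y + z) (z + x) z x y
  have p1 : omegaRect F y z x = omegaRect F x y z := by
    rw [omegaRect_swap₁₃ F y z x, omegaRect_swap₂₃ F x z y]
  have p2 : omegaRect F z x y = omegaRect F x y z := by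
    rw [omegaRect_swap₁₂ F z x y, omegaRect_swap₂₃ F x z y]
  have hhom := LottiRomani1983_homogeneous F (ν := x + y + z) (x := 1) (y := 1) (z := 1)
    (by linarith) zero_le_one zero_le_one zero_le_one
  rw [mul_one, omegaRect_one_one_one] at hhom
  rw [show y + z + x = x + y + z by ring, show z + x + y = x + y + z by ring, hhom, p2] at h2
  rw [p1] at h1
  linarith

/-- **Mass law**: a family of rectangular shapes `(x_i, y_i, z_i) ≥ 0` costs at least `ω/3` per unit of
bond mass: `(Σ_i (x_i+y_i+z_i))·ω ≤ 3·Σ_i ω(x_i,y_i,z_i)` (symmetrisation, term by term).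
[cite: Blaser2013, Theorem 5.9] [cite: LottiRomani1983, §1] -/
theorem mass_mul_omega_le_three_mul_coverCost {ι : Type*} (s : Finset ι) {x y z : ι → ℝ}
    (hx : ∀ i ∈ s, 0 ≤ x i) (hy : ∀ i ∈ s, 0 ≤ y i) (hz : ∀ i ∈ s, 0 ≤ z i) :
    (∑ i ∈ s, (x i + y i + z i)) * omega F ≤ 3 * ∑ i ∈ s, omegaRect F (x i) (y i) (z i) := by
  rw [Finset.sum_mul, Finset.mul_sum]
  exact Finset.sum_le_sum fun i hi =>
    sum_mul_omega_le_three_mul_omegaRect F (hx i hi) (hy i hi) (hz i hi)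

/-! ## §2 The ceiling -/

/-- **Every cover certificate of `T(K₄)` costs at least `2ω`**: bond mass `≥ 6` (flattening `n³` at each
of the four vertices) and the mass law. [cite: Blaser2013, Theorem 5.9] -/
theorem two_mul_omega_le_coverCost {ι : Type*} (s : Finset ι) {x y z : ι → ℝ}
    (hx : ∀ i ∈ s, 0 ≤ x i) (hy : ∀ i ∈ s, 0 ≤ y i) (hz : ∀ i ∈ s, 0 ≤ z i)
    (hmass : 6 ≤ ∑ i ∈ s, (x i + y i + z i)) :
    2 * omega F ≤ ∑ i ∈ s, omegaRect F (x i) (y i) (z i) := by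
  have h := mass_mul_omega_le_three_mul_coverCost F s hx hy hz
  have hω : 0 ≤ omega F := le_trans (by norm_num) (omega_two_le F)
  have h6 : 6 * omega F ≤ (∑ i ∈ s, (x i + y i + z i)) * omega F :=
    mul_le_mul_of_nonneg_right hmass hω
  linarith

/-- **Weighted ceiling** (the sixth-edge ladder): a cover certificate of bond mass `≥ 5 + δ` and cost
`≤ ω(2,1,2)` forces `(5+δ)·ω ≤ 3·ω(2,1,2)` — at `δ = 1` the summit, below it an absolute bound on `ω`.
[cite: Blaser2013, Theorem 5.9] -/
theorem weightedCover_ceiling {ι : Type*} (s : Finset ι) {x y z : ι → ℝ} {δ : ℝ}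
    (hx : ∀ i ∈ s, 0 ≤ x i) (hy : ∀ i ∈ s, 0 ≤ y i) (hz : ∀ i ∈ s, 0 ≤ z i)
    (hmass : 5 + δ ≤ ∑ i ∈ s, (x i + y i + z i))
    (hcost : ∑ i ∈ s, omegaRect F (x i) (y i) (z i) ≤ omegaRect F 2 1 2) :
    (5 + δ) * omega F ≤ 3 * omegaRect F 2 1 2 := by
  have h := mass_mul_omega_le_three_mul_coverCost F s hx hy hz
  have hω : 0 ≤ omega F := le_trans (by norm_num) (omega_two_le F)
  have h5 : (5 + δ) * omega F ≤ (∑ i ∈ s, (x i + y i + z i)) * omega F :=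
    mul_le_mul_of_nonneg_right hmass hω
  linarith

end AnyField

/-! ## §3 At the route's declarations (`ℂ`) -/

section Route

/-- **A matrix-multiplication cover certifies `TetraExcessZero` only at the summit**: shapes
`(x_i,y_i,z_i) ≥ 0` of bond mass `≥ 6` and total cost `≤ ω(2,1,2)` force `ω = 2`.
[cite: Blaser2013, Theorem 5.9] [cite: ChristandlVranaZuiddam2016, §1.3] -/
theorem matrixMultiplication_of_coverCertificate {ι : Type*} (s : Finset ι) {x y z : ι → ℝ}
    (hx : ∀ i ∈ s, 0 ≤ x i) (hy : ∀ i ∈ s, 0 ≤ y i) (hz : ∀ i ∈ s, 0 ≤ z i)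
    (hmass : 6 ≤ ∑ i ∈ s, (x i + y i + z i))
    (hcost : ∑ i ∈ s, omegaRect ℂ (x i) (y i) (z i) ≤ omegaRect ℂ 2 1 2) : _root_.MatrixMultiplication :=
  (ConeTensor.two_mul_omega_le_omegaRect_two_one_two_iff).1
    ((two_mul_omega_le_coverCost ℂ s hx hy hz hmass).trans hcost)

/-- Conversely the summit makes the balanced four-triangle cover (`4 × (1/2,1/2,1/2)`, mass `6`, cost
`4·ω(1/2,1/2,1/2) = 2ω`) a certificate: the cover class certifies the leaf IFF `ω = 2`. [folklore] -/
theorem coverCertificate_balanced_iff :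
    4 * omegaRect ℂ (1 / 2) (1 / 2) (1 / 2) ≤ omegaRect ℂ 2 1 2 ↔ _root_.MatrixMultiplication := by
  have hhom := LottiRomani1983_homogeneous ℂ (ν := 1 / 2) (x := 1) (y := 1) (z := 1)
    (by norm_num) zero_le_one zero_le_one zero_le_one
  rw [mul_one, omegaRect_one_one_one] at hhom
  have h4 : 4 * omegaRect ℂ (1 / 2) (1 / 2) (1 / 2) = 2 * omega ℂ := by rw [hhom]; ring
  rw [h4]
  exact ConeTensor.two_mul_omega_le_omegaRect_two_one_two_iff

end Route

end Summit.MatrixMultiplication.MatrixMultiplication.Theorems.EdgePencil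

end
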